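import Summits.BirchSwinnertonDyer.Rank1Residual.ManinAdditive.CuspidalKummerClass
import Summits.BirchSwinnertonDyer.Rank1Residual.ManinAdditive.KatoShiftThreeLaws
import Literature.NumberTheory.EllipticCurves.Isogeny
import Literature.NumberTheory.EllipticCurves.QuadraticTwist
import HarnessLib
import HarnessLib.Audit.Tags

/-!
# LAW₃ `CuspidalKummerCubeExponentLaw`, RES₃ `NoRationalThreeTorsionResidual`, RES₃′
# `NoRationalThreeTorsionOrbitMinimalResidual` — the `p = 3` cuspidal-Kummer cube programme's law and residuals,
# BY NAME (cell `bsd-f2-manin`; lead `bsd-line-manin23-p1` typing ask A-p1-1, 2026-08-28T09:45:35Z)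

HONEST FRAMING.  LENS = analytic / period-lattice (planner `bsd-f2-manin-an`, MEMO-an §56.7/§56.12: the tangent-line
Kummer class of a rational `3`-torsion point, rows E-an-55–58 of `CuspidalKummerClass.lean`) as consumed by the C3 lead
`bsd-line-manin23-p1` (gen 4).  The three declarations below are the INLINE hypotheses `hLaw` / `hRes` of the ACCEPTED
tree theorems of `Summits/BirchSwinnertonDyer/BirchSwinnertonDyer/Theorems/ManinLocalTwoThreeManinPrimeToThreeOfReducibleOfCuspidalKummer.lean`
(p621918, commit 71eac898dd9d: `maninPrimeToThreeOfReducible_of_cuspidalKummerCube : E-an-57 → E-an-55 → LAW₃ → RES₃ →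
ManinPrimeToThreeOfReducible`, `orbitMinimalReducibleResidualThree_of_cuspidalKummerCube` with RES₃′) copied VERBATIM
and given NAMES, so that the C3 line `kato_shift_three` (skeleton v7, stubs `stub_cubeExponentLaw`,
`stub_noRationalThreeTorsionOrbitMinimalResidual` registered on stmt-BirchSwinnertonDyer-22968) can cite them by name
(lead 09:45:35Z (4) «TYPING ASK A-p1-1 → -an / -ty: file LAW₃ and RES₃/RES₃′ as `@[conjecture]` leaves next to
E-an-55…58 … copy verbatim»).  They live in a sibling file because `CuspidalKummerClass.lean` is at 305 lines and RES₃′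
carries the six twist-orbit-minimality clauses of p617384 (`IsIsogenous`, `quadraticTwist`).

* **LAW₃ `CuspidalKummerCubeExponentLaw`** — the `p = 3` twin of E-an-53 `CuspidalKummerOddExponent`: every cuspidal
  Kummer CUBE representative `(r, g, A, B)` (`IsCuspidalKummerCubeRep`) of the tangent-line Kummer series of a rational
  point of order `3` on the short model `E_{W,c}` (`IsShortThreeTorsion`, `IsParamGerm`, `kummerCubeSeries`) of an
  `X₀(N)`-parametrised `W` with `9 ∣ N` has SOME `η`-exponent `r_δ ≢ 0 (mod 3)`.  `c`-free, per-curve decidable;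
  an's census (MEMO-an §56.7): the intrinsic class is a non-cube in 496 / 496 classes of `Rb(3)`, `N ≤ 5000`, with a
  rational point of order `3` («0 blind at `p = 3`»).  A LAW, OPEN; with E-an-57 (K_geo₃) and E-an-55 (Honda at `3`)
  it gives `3 ∤ c` on that locus (p621918).
* **RES₃ `NoRationalThreeTorsionResidual`** — the honest residual: an `X₀(N)`-optimal `W` (lattice clause), `3² ∣ N`,
  `W[3]` REDUCIBLE, with NO rational point of order `3` on the short model (`∀ X₀ Y₀, ¬ IsShortThreeTorsion W D.c X₀ Y₀`;
  a `3`-isogeny whose kernel is not pointwise rational; 233 / 729 classes of `Rb(3)`, `N ≤ 5000`) has `3 ∤ c`.  An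
  instance of Manin's `c = 1` (all `c = 1` in Cremona's range); an: «twisted variant needed»; no mechanism claimed.
* **RES₃′ `NoRationalThreeTorsionOrbitMinimalResidual`** — RES₃ restricted by the six twist-orbit-minimality clauses
  of p617384 (VERBATIM from p621918's `orbitMinimalReducibleResidualThree_of_cuspidalKummerCube`), the form the C3
  skeleton's `stub_noRationalThreeTorsionOrbitMinimalResidual` uses; RES₃ ⇒ RES₃′ trivially
  (`noRationalThreeTorsionOrbitMinimalResidual_of_residual`, PROVED).
* **RES₃♭ `NoRationalThreeTorsionCoprimeIsolatedResidual`** (appended, an g20 §4 / ask T-an-26, typer g12) — RES₃′ with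
  ONE more exclusion (clause 7: no same-`3`-level coprime twist partner with a rational short-model `3`-torsion point);
  RES₃′ ⇒ RES₃♭ trivially and RES₃♭ ⇒ RES₃′ given the clause-7 certificate (E-an-93, p628287) — both edges PROVED below.

REFUTER STATUS at filing: the parent rows E-an-53 / E-an-50 / E-an-55–58 SURVIVE refuter-1 §R50 (R-an-29 (a)); LAW₃,
RES₃, RES₃′ themselves are the lead's inline statements (kernel-typed in p621918) and have NOT yet had a refuter-1
by-name probe as rows — asked at filing (typer INBOX line); refuter-2 placement pending.  Why LAW₃ might fail: a rational
`3`-torsion point at `9 ∣ N` whose cuspidal class `ι(T)` is a CUBE in the cuspidal group (all `r_δ ≡ 0 (mod 3)`) — an's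
census found none ≤ 5000; at `27 ∣ N` not all cusps are rational (generalized `η`-quotients, an's hedge, prose only).
Nearest print: Ligozat (η-quotient units on `X₀(N)`), Newman's conditions; Agashe 2018 Thm. 1.1 (rational torsion vs the
cuspidal group at square-free level) — nothing at `9 ∣ N` for `3`-torsion classes.  Beyond-print theorem: no.  BSD is
not proved by this; Manin's conjecture is not proved by this.
-/

set_option autoImplicit false

noncomputable section

open PowerSeries CongruenceSubgroup
open WeierstrassCurve Literature.NumberTheory.EllipticCurves Literature.NumberTheory.EllipticCurves.ModularForms

namespace Summit.BirchSwinnertonDyer.Rank1Residual.ManinAdditive.CuspidalKummerThree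

open Summit.BirchSwinnertonDyer.Rank1Residual.ManinAdditive.CuspidalKummer

/-- **LAW₃ `CuspidalKummerCubeExponentLaw` (cell bsd-f2-manin; the `p = 3` twin of E-an-53; nothing asserted; an's
census 496 / 496, `N ≤ 5000`): every cuspidal Kummer cube representative of a rational point of order `3` on the short
model of an `X₀(N)`-parametrised curve with `9 ∣ N` has an `η`-exponent not divisible by `3`.**  VERBATIM the hypothesis
`hLaw` of p621918's `maninPrimeToThreeOfReducible_of_cuspidalKummerCube` (lead bsd-line-manin23-p1 gen 4).  OPEN law,
`c`-free; REF1 by-name probe pending at filing.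
[cite: Agashe2018, Thm. 1.1 (shape only: rational torsion inside the cuspidal group at square-free level; the `9 ∣ N` cube-exponent law is the cell's LAW₃, NOT in print — MEMO-an §56.7, p621918)] -/
@[conjecture]
def CuspidalKummerCubeExponentLaw : Prop :=
  ∀ (W : WeierstrassCurve ℚ) [W.IsElliptic] [W.IsGloballyMinimal] {N : ℕ} [NeZero N]
    (D : ModularParametrizationData W N) (a : ℕ → ℤ), (∀ n, (a n : ℂ) = cuspCoeff D.f n) →
    9 ∣ N → (∀ z ∈ D.L.lattice, ∃ w ∈ periodLattice D.f, z = D.c * w) →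
    ∀ X₀ Y₀ : ℚ, IsShortThreeTorsion W D.c X₀ Y₀ →
    ∀ z : ℚ⟦X⟧, IsParamGerm W D.c a z →
    ∀ (r : ℕ → ℤ) (g A B : ℤ⟦X⟧), IsCuspidalKummerCubeRep N (kummerCubeSeries W D.c X₀ Y₀ z) r g A B →
    ∃ δ ∈ N.divisors, ¬ (3 : ℤ) ∣ r δ

/-- **RES₃ `NoRationalThreeTorsionResidual` (cell bsd-f2-manin; honest residual, nothing asserted; 233 / 729 classes of
`Rb(3)`, `N ≤ 5000`, all `c = 1`): an `X₀(N)`-optimal curve with `3² ∣ N`, `W[3]` reducible and NO rational point of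
order `3` on the short model `E_{W,c}` has `3 ∤ c`.**  VERBATIM the hypothesis `hRes` of p621918's
`maninPrimeToThreeOfReducible_of_cuspidalKummerCube`.  An instance of Manin's `c = 1`; no mechanism claimed (an: «twisted
variant needed»); REF1 by-name probe pending at filing.
[cite: Wuthrich2014, Thm. 4 (shape only: lattice integrality under reducibility at SEMISTABLE primes; the additive-3 residual is the cell's RES₃, NOT in print — p621918, MEMO-an §56.7)] -/
@[conjecture]
def NoRationalThreeTorsionResidual : Prop :=
  ∀ (W : WeierstrassCurve ℚ) [W.IsElliptic] [W.IsGloballyMinimal] {N : ℕ} [NeZero N]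
    (D : ModularParametrizationData W N),
    (∀ z ∈ D.L.lattice, ∃ w ∈ periodLattice D.f, z = D.c * w) → 3 ^ 2 ∣ N →
    ¬ W.HasIrreducibleModPGaloisRep 3 → (∀ X₀ Y₀ : ℚ, ¬ IsShortThreeTorsion W D.c X₀ Y₀) → ¬ (3 : ℤ) ∣ D.c

/-- **RES₃′ `NoRationalThreeTorsionOrbitMinimalResidual` (cell bsd-f2-manin; nothing asserted): RES₃ restricted by the
six twist-orbit-minimality clauses of p617384** (no `ℚ(√−3)`-twist partner of lower `3`-level; no `q*`-twist partner of
lower `q`-level, `q ≠ 2, 3`; no `−1, ±2`-twist partner of lower `2`-level; the three `2`-adic descent exclusions) — the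
form consumed by the C3 skeleton's `stub_noRationalThreeTorsionOrbitMinimalResidual`.  VERBATIM the hypothesis `hRes` of
p621918's `orbitMinimalReducibleResidualThree_of_cuspidalKummerCube`.  REF1 by-name probe pending at filing.
[cite: Wuthrich2014, Thm. 4 (shape only: as for RES₃; the orbit-minimal additive-3 residual is the cell's RES₃′, NOT in print — p621918, p617384)] -/
@[conjecture]
def NoRationalThreeTorsionOrbitMinimalResidual : Prop :=
  ∀ (W : WeierstrassCurve ℚ) [W.IsElliptic] [W.IsGloballyMinimal] {N : ℕ} [NeZero N]
    (D : ModularParametrizationData W N),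
    (∀ z ∈ D.L.lattice, ∃ w ∈ periodLattice D.f, z = D.c * w) → 3 ^ 2 ∣ N →
    ¬ (∃ (W' : WeierstrassCurve ℚ) (d : ℤ), W'.IsElliptic ∧ W'.IsGloballyMinimal ∧
      (d = -3) ∧ IsIsogenous W (W'.quadraticTwist (d : ℚ)) ∧
      ¬ 3 ^ 2 ∣ W'.conductorNorm ℤ) →
    ¬ (∃ (W' : WeierstrassCurve ℚ) (q : ℕ), W'.IsElliptic ∧ W'.IsGloballyMinimal ∧
      q.Prime ∧ q ≠ 2 ∧ q ≠ 3 ∧ q ^ 2 ∣ N ∧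
      IsIsogenous W (W'.quadraticTwist (((-1 : ℤ) ^ (q / 2) * q : ℤ) : ℚ)) ∧
      ¬ q ^ 2 ∣ W'.conductorNorm ℤ) →
    ¬ (∃ (W' : WeierstrassCurve ℚ) (d : ℤ), W'.IsElliptic ∧ W'.IsGloballyMinimal ∧
      (d = -1 ∨ d = 2 ∨ d = -2) ∧ 2 ^ 2 ∣ N ∧ IsIsogenous W (W'.quadraticTwist (d : ℚ)) ∧
      ¬ 2 ^ 2 ∣ W'.conductorNorm ℤ) →
    ¬ (∃ (A : WeierstrassCurve ℚ), A.IsElliptic ∧ A.IsGloballyMinimal ∧ 2 ^ 4 ∣ N ∧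
      2 ^ 2 ∣ A.conductorNorm ℤ ∧ A.conductorNorm ℤ ∣ N ∧ A.conductorNorm ℤ < N ∧
      IsIsogenous W (A.quadraticTwist ((-1 : ℤ) : ℚ))) →
    ¬ (∃ (A : WeierstrassCurve ℚ) (_ : A.IsElliptic) (_ : A.IsGloballyMinimal) (N' : ℕ) (_ : NeZero N')
      (D' : ModularParametrizationData A N') (d : ℤ) (C : WeierstrassCurve ℚ) (u : VariableChange ℚ),
      C.IsElliptic ∧ C.IsGloballyMinimal ∧
      (∀ z ∈ D'.L.lattice, ∃ w ∈ periodLattice D'.f, z = D'.c * w) ∧ (d = 2 ∨ d = -2) ∧ 2 ^ 6 ∣ N ∧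
      2 ^ 2 ∣ A.conductorNorm ℤ ∧ A.conductorNorm ℤ ∣ N ∧
      IsIsogenous W (A.quadraticTwist (d : ℚ)) ∧ u • A.quadraticTwist (d : ℚ) = C ∧
      C.Δ = (d : ℚ) ^ 6 * A.Δ ∧
      (A.conductorNorm ℤ < N ∨ A.minimalDiscriminantInt.natAbs < W.minimalDiscriminantInt.natAbs)) →
    ¬ (∃ (A : WeierstrassCurve ℚ) (_ : A.IsElliptic) (_ : A.IsGloballyMinimal)
      (D' : ModularParametrizationData A N) (q : ℕ) (C : WeierstrassCurve ℚ) (u : VariableChange ℚ),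
      C.IsElliptic ∧ C.IsGloballyMinimal ∧
      (∀ z ∈ D'.L.lattice, ∃ w ∈ periodLattice D'.f, z = D'.c * w) ∧ q.Prime ∧ q ≠ 2 ∧ q ^ 2 ∣ N ∧
      IsIsogenous C W ∧ u • A.quadraticTwist (((-1 : ℤ) ^ (q / 2) * q : ℤ) : ℚ) = C ∧
      C.Δ = ((((-1 : ℤ) ^ (q / 2) * q : ℤ)) : ℚ) ^ 6 * A.Δ ∧
      A.minimalDiscriminantInt.natAbs < W.minimalDiscriminantInt.natAbs) →
    ¬ W.HasIrreducibleModPGaloisRep 3 → (∀ X₀ Y₀ : ℚ, ¬ IsShortThreeTorsion W D.c X₀ Y₀) → ¬ (3 : ℤ) ∣ D.c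

/-- RES₃ ⇒ RES₃′: the orbit-minimal residual is the plain residual with six extra (unused) hypotheses. (PROVED.) -/
theorem noRationalThreeTorsionOrbitMinimalResidual_of_residual (h : NoRationalThreeTorsionResidual) :
    NoRationalThreeTorsionOrbitMinimalResidual :=
  fun W _ _ _ _ D hL h9 _ _ _ _ _ _ hred hT ↦ h W D hL h9 hred hT

/-- On the complementary locus (SOME rational point of order `3` on the short model) LAW₃ hands the `p = 3`
certificate E-an-58 `ManinPrimeToThreeOfEtaExponent` its non-cube exponent: E-an-57 ∧ LAW₃ ∧ E-an-58 ⇒ `3 ∤ c` there.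
(One-line edge, PROVED; the composition with E-an-55 and RES₃ into `ManinPrimeToThreeOfReducible` is p621918's
`maninPrimeToThreeOfReducible_of_cuspidalKummerCube` under `Theorems/`.) -/
theorem not_three_dvd_maninConstant_of_shortThreeTorsion (h57 : CuspidalKummerCubeRepresentativeAtNine)
    (hLaw : CuspidalKummerCubeExponentLaw) (h58 : ManinPrimeToThreeOfEtaExponent)
    (W : WeierstrassCurve ℚ) [W.IsElliptic] [W.IsGloballyMinimal] {N : ℕ} [NeZero N]
    (D : ModularParametrizationData W N) (a : ℕ → ℤ) (ha : ∀ n, (a n : ℂ) = cuspCoeff D.f n) (h9 : 9 ∣ N)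
    (hL : ∀ z ∈ D.L.lattice, ∃ w ∈ periodLattice D.f, z = D.c * w) {X₀ Y₀ : ℚ}
    (hT : IsShortThreeTorsion W D.c X₀ Y₀) {z : ℚ⟦X⟧} (hz : IsParamGerm W D.c a z) : ¬ (3 : ℤ) ∣ D.c := by
  obtain ⟨r, g, A, B, hrep⟩ := h57 W D a ha h9 hL X₀ Y₀ hT z hz
  exact h58 W D a ha h9 X₀ Y₀ hT z hz r g A B hrep (hLaw W D a ha h9 hL X₀ Y₀ hT z hz r g A B hrep)

/-- The dichotomy behind p621918, BY NAME and without E-an-55: if every `X₀(N)`-optimal `W` with `9 ∣ N` and a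
rational short-model `3`-torsion point has `3 ∤ c` (e.g. from E-an-57 ∧ LAW₃ ∧ E-an-58), then RES₃ is exactly what is
missing for `ManinPrimeToThreeOfReducible`. (PROVED; `IsParamGerm` witnesses exist by `exists_isParamGerm`.) -/
theorem maninPrimeToThreeOfReducible_of_shortThreeTorsion_of_residual
    (hTors : ∀ (W : WeierstrassCurve ℚ) [W.IsElliptic] [W.IsGloballyMinimal] {N : ℕ} [NeZero N]
      (D : ModularParametrizationData W N), 9 ∣ N →
      (∀ z ∈ D.L.lattice, ∃ w ∈ periodLattice D.f, z = D.c * w) →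
      ∀ X₀ Y₀ : ℚ, IsShortThreeTorsion W D.c X₀ Y₀ → ¬ (3 : ℤ) ∣ D.c)
    (hRes : NoRationalThreeTorsionResidual) : ManinPrimeToThreeOfReducible := by
  intro W _ _ N _ D hL h9 hred
  have h9' : 9 ∣ N := by norm_num at h9; exact h9
  by_cases hT : ∃ X₀ Y₀ : ℚ, IsShortThreeTorsion W D.c X₀ Y₀
  · obtain ⟨X₀, Y₀, hT⟩ := hT
    exact hTors W D h9' hL X₀ Y₀ hT
  · push Not at hT
    exact hRes W D hL h9 hred hT

/-! ## RES₃♭ `NoRationalThreeTorsionCoprimeIsolatedResidual` — the coprime-isolated re-cut of RES₃′ (an g20 §4, ask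
T-an-26 / lead bsd-line-manin23-p1 2026-08-28T11:35:24Z «§4 RES₃♭ def + 2 split edges remain -ty's»; appended by the
cell typer, gen 12).  Source HOME/an/Sketch-an-g20.lean 6866045b410cb4f3 §4 (farm rc 0), the `def` VERBATIM; the two
route-free edges below are PROVED here; an's Theorems-side split `noRationalThreeTorsionOrbitMinimalResidual_of_coprimeIsolated :
hTors → RES₃♭ → RES₃′` composes `…_of_coprimeIsolated_of_partnerCertificate` (below) with E-an-93
`Summit.BirchSwinnertonDyer.BirchSwinnertonDyer.Theorems.not_three_dvd_maninConstant_of_coprimeTwistPartner_shortThreeTorsion`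
(p628287, `Theorems/ManinLocalTwoThreeCoprimeTwistTransportThree.lean`, whose imports lie in the route cone — hence not
importable here; hand-over HOME/typer/ManinLocalTwoThreeCoprimeIsolatedResidualSplit.handover.lean).  REFUTER STATUS at
filing: refuter-1 by-name probe R-an-36 (RES₃♭ / E-an-93) PENDING — filed on the lead's explicit ask (precedent T-imc-8b);
refuter-2 placement pending.  Census (an g20, `N ≤ 5000`; data D-an-18, `N < 5·10⁵`, HOME/data/D-an-18-coprime-partners-v1.tsv
635e16e40aa136c5): see the docstring.  BSD is not proved by this; Manin's conjecture is not proved by this. -/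

/-- **RES₃♭ `NoRationalThreeTorsionCoprimeIsolatedResidual` (cell bsd-f2-manin, an g20; honest residual, nothing
asserted): RES₃′ (`NoRationalThreeTorsionOrbitMinimalResidual`, verbatim) with ONE more exclusion (clause 7): there is
NO same-`3`-level COPRIME twist partner carrying a rational short-model `3`-torsion point** — no prime `q ∉ {2, 3}` with
`q² ∣ N`, `q² ∣ N_W`, and a globally minimal `A` with a lattice-optimal `X₀(N')`-datum, `N' ∣ N`, `9 ∣ N'`, a globally
minimal `C = u • (A ⊗ ℚ(√q*)) ∼ W` of either alignment, and a rational point of order `3` on the short model `E_{A,c'}`.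
Census (`N ≤ 5000`, CUSPIMG × TWISTCENSUS2): of the 23 orbit-minimal classes with a non-rational cuspidal `3`-point and
no rational one, 13 leave by clause 7 (225a1, 441a1, 675e1, 882b1, 1089b1, 1323m1, 1350s1, 1521a1, 3267a1, 4050s1, 4050w1,
4563a1, 4761b1); 10 stay (270c1, 459c1, 594h1, 1485c1, 1566p1 — `χ₋₃`-partner only; 243a1, 486d1, 486e1, 1215d1, 2430m1).
Data seat D-an-18 (HOME/data/D-an-18-coprime-partners-v1.tsv 635e16e40aa136c5, `9 ∣ N < 5·10⁵`, optimal `W` with a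
rational `3`-isogeny and `3 ∤ #W(ℚ)_tors`: 38 275 rows, 3 050 orbit-minimal): reachable by a clause-7 partner 571 ·
`χ₋₃`-only 1 743 · isolated 659 (+ 77 CM); reaching edges with `3 ∣ isodeg`: 0 / 571.  VERBATIM §4 of
HOME/an/Sketch-an-g20.lean 6866045b410cb4f3 (ask T-an-26; lead bsd-line-manin23-p1 11:35:24Z); the C3 skeleton v9 of
`kato_shift_three` takes `stub_noRationalThreeTorsionCoprimeIsolatedResidual : NoRationalThreeTorsionCoprimeIsolatedResidual`
in place of stub 5.  REF1 by-name probe R-an-36 PENDING at filing; refuter-2 placement pending.  Why it might fail: as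
RES₃′ (an instance of Manin's `c = 1`; no mechanism claimed on the `χ₋₃`-only and isolated loci — es's non-real road
F-es-18♭K ∧ E-es-60 ∧ E-es-61 is the intended closer there).  Beyond-print theorem: no.
[cite: Wuthrich2014, Thm. 4 (shape only; the residual is the cell's RES₃♭, NOT in print — MEMO-an §62)] -/
@[conjecture]
def NoRationalThreeTorsionCoprimeIsolatedResidual : Prop :=
  ∀ (W : WeierstrassCurve ℚ) [W.IsElliptic] [W.IsGloballyMinimal] {N : ℕ} [NeZero N]
    (D : ModularParametrizationData W N),
    (∀ z ∈ D.L.lattice, ∃ w ∈ periodLattice D.f, z = D.c * w) → 3 ^ 2 ∣ N →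
    ¬ (∃ (W' : WeierstrassCurve ℚ) (d : ℤ), W'.IsElliptic ∧ W'.IsGloballyMinimal ∧
      (d = -3) ∧ IsIsogenous W (W'.quadraticTwist (d : ℚ)) ∧
      ¬ 3 ^ 2 ∣ W'.conductorNorm ℤ) →
    ¬ (∃ (W' : WeierstrassCurve ℚ) (q : ℕ), W'.IsElliptic ∧ W'.IsGloballyMinimal ∧
      q.Prime ∧ q ≠ 2 ∧ q ≠ 3 ∧ q ^ 2 ∣ N ∧
      IsIsogenous W (W'.quadraticTwist (((-1 : ℤ) ^ (q / 2) * q : ℤ) : ℚ)) ∧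
      ¬ q ^ 2 ∣ W'.conductorNorm ℤ) →
    ¬ (∃ (W' : WeierstrassCurve ℚ) (d : ℤ), W'.IsElliptic ∧ W'.IsGloballyMinimal ∧
      (d = -1 ∨ d = 2 ∨ d = -2) ∧ 2 ^ 2 ∣ N ∧ IsIsogenous W (W'.quadraticTwist (d : ℚ)) ∧
      ¬ 2 ^ 2 ∣ W'.conductorNorm ℤ) →
    ¬ (∃ (A : WeierstrassCurve ℚ), A.IsElliptic ∧ A.IsGloballyMinimal ∧ 2 ^ 4 ∣ N ∧
      2 ^ 2 ∣ A.conductorNorm ℤ ∧ A.conductorNorm ℤ ∣ N ∧ A.conductorNorm ℤ < N ∧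
      IsIsogenous W (A.quadraticTwist ((-1 : ℤ) : ℚ))) →
    ¬ (∃ (A : WeierstrassCurve ℚ) (_ : A.IsElliptic) (_ : A.IsGloballyMinimal) (N' : ℕ) (_ : NeZero N')
      (D' : ModularParametrizationData A N') (d : ℤ) (C : WeierstrassCurve ℚ) (u : VariableChange ℚ),
      C.IsElliptic ∧ C.IsGloballyMinimal ∧
      (∀ z ∈ D'.L.lattice, ∃ w ∈ periodLattice D'.f, z = D'.c * w) ∧ (d = 2 ∨ d = -2) ∧ 2 ^ 6 ∣ N ∧
      2 ^ 2 ∣ A.conductorNorm ℤ ∧ A.conductorNorm ℤ ∣ N ∧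
      IsIsogenous W (A.quadraticTwist (d : ℚ)) ∧ u • A.quadraticTwist (d : ℚ) = C ∧
      C.Δ = (d : ℚ) ^ 6 * A.Δ ∧
      (A.conductorNorm ℤ < N ∨ A.minimalDiscriminantInt.natAbs < W.minimalDiscriminantInt.natAbs)) →
    ¬ (∃ (A : WeierstrassCurve ℚ) (_ : A.IsElliptic) (_ : A.IsGloballyMinimal)
      (D' : ModularParametrizationData A N) (q : ℕ) (C : WeierstrassCurve ℚ) (u : VariableChange ℚ),
      C.IsElliptic ∧ C.IsGloballyMinimal ∧
      (∀ z ∈ D'.L.lattice, ∃ w ∈ periodLattice D'.f, z = D'.c * w) ∧ q.Prime ∧ q ≠ 2 ∧ q ^ 2 ∣ N ∧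
      IsIsogenous C W ∧ u • A.quadraticTwist (((-1 : ℤ) ^ (q / 2) * q : ℤ) : ℚ) = C ∧
      C.Δ = ((((-1 : ℤ) ^ (q / 2) * q : ℤ)) : ℚ) ^ 6 * A.Δ ∧
      A.minimalDiscriminantInt.natAbs < W.minimalDiscriminantInt.natAbs) →
    -- clause 7 (NEW, an g20): no same-3-level coprime twist partner (q² ∣ N_W: W additive at q) with a rational short 3-torsion point
    ¬ (∃ (A : WeierstrassCurve ℚ) (_ : A.IsElliptic) (_ : A.IsGloballyMinimal) (N' : ℕ) (_ : NeZero N')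
      (D' : ModularParametrizationData A N') (q : ℕ) (C : WeierstrassCurve ℚ) (u : VariableChange ℚ) (X₀ Y₀ : ℚ),
      C.IsElliptic ∧ C.IsGloballyMinimal ∧
      (∀ z ∈ D'.L.lattice, ∃ w ∈ periodLattice D'.f, z = D'.c * w) ∧ N' ∣ N ∧ 9 ∣ N' ∧
      q.Prime ∧ q ≠ 2 ∧ q ≠ 3 ∧ q ^ 2 ∣ N ∧
      q ^ 2 ∣ W.conductorNorm ℤ ∧
      IsIsogenous C W ∧ u • A.quadraticTwist (((-1 : ℤ) ^ (q / 2) * q : ℤ) : ℚ) = C ∧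
      (C.Δ = ((((-1 : ℤ) ^ (q / 2) * q : ℤ)) : ℚ) ^ 6 * A.Δ ∨
        (q : ℚ) ^ 12 * C.Δ = ((((-1 : ℤ) ^ (q / 2) * q : ℤ)) : ℚ) ^ 6 * A.Δ) ∧
      IsShortThreeTorsion A D'.c X₀ Y₀) →
    ¬ W.HasIrreducibleModPGaloisRep 3 → (∀ X₀ Y₀ : ℚ, ¬ IsShortThreeTorsion W D.c X₀ Y₀) → ¬ (3 : ℤ) ∣ D.c

/-- RES₃′ ⇒ RES₃♭ (the re-cut residual is WEAKER: one more unused hypothesis). (PROVED; an g20 §4 verbatim.) -/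
theorem noRationalThreeTorsionCoprimeIsolatedResidual_of_orbitMinimal
    (h : NoRationalThreeTorsionOrbitMinimalResidual) : NoRationalThreeTorsionCoprimeIsolatedResidual :=
  fun W _ _ _ _ D hL h9 h1 h2 h3 h4 h5 h6 _ hred hT ↦ h W D hL h9 h1 h2 h3 h4 h5 h6 hred hT

/-- RES₃ ⇒ RES₃♭ (PROVED; composition of the two weakening edges). -/
theorem noRationalThreeTorsionCoprimeIsolatedResidual_of_residual (h : NoRationalThreeTorsionResidual) :
    NoRationalThreeTorsionCoprimeIsolatedResidual :=
  noRationalThreeTorsionCoprimeIsolatedResidual_of_orbitMinimal (noRationalThreeTorsionOrbitMinimalResidual_of_residual h)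

/-- **THE SPLIT, route-free half (PROVED): RES₃′ ⟸ (clause-7 certificate) ∧ RES₃♭.**  Excluded middle on clause 7:
if every globally minimal `W` with a lattice-optimal `X₀(N)`-datum that ADMITS the data of clause 7 (a same-`3`-level
coprime twist partner `A`, `N' ∣ N`, `9 ∣ N'`, `q ∉ {2, 3}`, `q² ∣ N`, `q² ∣ N_W`, either alignment, with a rational
short-model `3`-torsion point) has `3 ∤ c(D_W)` — the conclusion of E-an-93
`Summit.BirchSwinnertonDyer.BirchSwinnertonDyer.Theorems.not_three_dvd_maninConstant_of_coprimeTwistPartner_shortThreeTorsion`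
(p628287) fed by its `hTors` (⟸ E-an-57 ∧ LAW₃ ∧ E-an-58, `…_of_shortThreeTorsion_forall`) and by
`…ManinLocalTwoThree.not_good_and_not_mult_of_sq_dvd_conductorNorm` — then RES₃♭ yields RES₃′ verbatim.  The
Theorems-side one-liner `noRationalThreeTorsionOrbitMinimalResidual_of_coprimeIsolated : hTors → RES₃♭ → RES₃′`
(an g20 §4) is this edge with `hCert` so instantiated; it lives under `Theorems/` because E-an-93's module imports the
route file.  CONDITIONAL edge; nothing about BSD is proved. -/
theorem noRationalThreeTorsionOrbitMinimalResidual_of_coprimeIsolated_of_partnerCertificate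
    (hCert : ∀ (W : WeierstrassCurve ℚ) [W.IsElliptic] [W.IsGloballyMinimal] {N : ℕ} [NeZero N]
      (D : ModularParametrizationData W N),
      (∀ z ∈ D.L.lattice, ∃ w ∈ periodLattice D.f, z = D.c * w) →
      (∃ (A : WeierstrassCurve ℚ) (_ : A.IsElliptic) (_ : A.IsGloballyMinimal) (N' : ℕ) (_ : NeZero N')
        (D' : ModularParametrizationData A N') (q : ℕ) (C : WeierstrassCurve ℚ) (u : VariableChange ℚ) (X₀ Y₀ : ℚ),
        C.IsElliptic ∧ C.IsGloballyMinimal ∧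
        (∀ z ∈ D'.L.lattice, ∃ w ∈ periodLattice D'.f, z = D'.c * w) ∧ N' ∣ N ∧ 9 ∣ N' ∧
        q.Prime ∧ q ≠ 2 ∧ q ≠ 3 ∧ q ^ 2 ∣ N ∧
        q ^ 2 ∣ W.conductorNorm ℤ ∧
        IsIsogenous C W ∧ u • A.quadraticTwist (((-1 : ℤ) ^ (q / 2) * q : ℤ) : ℚ) = C ∧
        (C.Δ = ((((-1 : ℤ) ^ (q / 2) * q : ℤ)) : ℚ) ^ 6 * A.Δ ∨
          (q : ℚ) ^ 12 * C.Δ = ((((-1 : ℤ) ^ (q / 2) * q : ℤ)) : ℚ) ^ 6 * A.Δ) ∧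
        IsShortThreeTorsion A D'.c X₀ Y₀) → ¬ (3 : ℤ) ∣ D.c)
    (hRes : NoRationalThreeTorsionCoprimeIsolatedResidual) : NoRationalThreeTorsionOrbitMinimalResidual := by
  intro W _ _ N _ D hL h9 h1 h2 h3 h4 h5 h6 hred hT
  by_cases h7 : ∃ (A : WeierstrassCurve ℚ) (_ : A.IsElliptic) (_ : A.IsGloballyMinimal) (N' : ℕ) (_ : NeZero N')
      (D' : ModularParametrizationData A N') (q : ℕ) (C : WeierstrassCurve ℚ) (u : VariableChange ℚ) (X₀ Y₀ : ℚ),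
      C.IsElliptic ∧ C.IsGloballyMinimal ∧
      (∀ z ∈ D'.L.lattice, ∃ w ∈ periodLattice D'.f, z = D'.c * w) ∧ N' ∣ N ∧ 9 ∣ N' ∧
      q.Prime ∧ q ≠ 2 ∧ q ≠ 3 ∧ q ^ 2 ∣ N ∧
      q ^ 2 ∣ W.conductorNorm ℤ ∧
      IsIsogenous C W ∧ u • A.quadraticTwist (((-1 : ℤ) ^ (q / 2) * q : ℤ) : ℚ) = C ∧
      (C.Δ = ((((-1 : ℤ) ^ (q / 2) * q : ℤ)) : ℚ) ^ 6 * A.Δ ∨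
        (q : ℚ) ^ 12 * C.Δ = ((((-1 : ℤ) ^ (q / 2) * q : ℤ)) : ℚ) ^ 6 * A.Δ) ∧
      IsShortThreeTorsion A D'.c X₀ Y₀
  · exact hCert W D hL h7
  · exact hRes W D hL h9 h1 h2 h3 h4 h5 h6 h7 hred hT

/-- The split as an EQUIVALENCE under the clause-7 certificate: given `hCert`, RES₃′ ⟺ RES₃♭ (PROVED). -/
theorem noRationalThreeTorsionOrbitMinimalResidual_iff_coprimeIsolated_of_partnerCertificate
    (hCert : ∀ (W : WeierstrassCurve ℚ) [W.IsElliptic] [W.IsGloballyMinimal] {N : ℕ} [NeZero N]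
      (D : ModularParametrizationData W N),
      (∀ z ∈ D.L.lattice, ∃ w ∈ periodLattice D.f, z = D.c * w) →
      (∃ (A : WeierstrassCurve ℚ) (_ : A.IsElliptic) (_ : A.IsGloballyMinimal) (N' : ℕ) (_ : NeZero N')
        (D' : ModularParametrizationData A N') (q : ℕ) (C : WeierstrassCurve ℚ) (u : VariableChange ℚ) (X₀ Y₀ : ℚ),
        C.IsElliptic ∧ C.IsGloballyMinimal ∧
        (∀ z ∈ D'.L.lattice, ∃ w ∈ periodLattice D'.f, z = D'.c * w) ∧ N' ∣ N ∧ 9 ∣ N' ∧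
        q.Prime ∧ q ≠ 2 ∧ q ≠ 3 ∧ q ^ 2 ∣ N ∧
        q ^ 2 ∣ W.conductorNorm ℤ ∧
        IsIsogenous C W ∧ u • A.quadraticTwist (((-1 : ℤ) ^ (q / 2) * q : ℤ) : ℚ) = C ∧
        (C.Δ = ((((-1 : ℤ) ^ (q / 2) * q : ℤ)) : ℚ) ^ 6 * A.Δ ∨
          (q : ℚ) ^ 12 * C.Δ = ((((-1 : ℤ) ^ (q / 2) * q : ℤ)) : ℚ) ^ 6 * A.Δ) ∧
        IsShortThreeTorsion A D'.c X₀ Y₀) → ¬ (3 : ℤ) ∣ D.c) :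
    NoRationalThreeTorsionOrbitMinimalResidual ↔ NoRationalThreeTorsionCoprimeIsolatedResidual :=
  ⟨noRationalThreeTorsionCoprimeIsolatedResidual_of_orbitMinimal,
    noRationalThreeTorsionOrbitMinimalResidual_of_coprimeIsolated_of_partnerCertificate hCert⟩

end Summit.BirchSwinnertonDyer.Rank1Residual.ManinAdditive.CuspidalKummerThree

end
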